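import Mathlib
import Summits.Parity.GeneralizedHardyLittlewood.Theorems.PrimeGapInitialSegmentPart1
import HarnessLib

/-!
# Prime-gap limit points: the cap on the initial segment `[0, 7·inf U]` and the density of `𝓛` on `[0, 7c]` (cell parity-ideate, p4 ROUNDS 13–16, line L9) — part 2/4 (`volume_le_half_of_reflection` … `AdditiveLemma`)

Source: `HOME/parity-ideate-p4/round16/Sketch20.lean` (sha16 b835d559e74496fc, 4 997 lines, farm rc 0 / 0 warnings / 0 sorry /
axioms std-3; namespace `ParityIdeateP4R15`), §0–§3, cut by parity-ideate-p4 g19 (`ports/w7/build_w7.py`, pattern of lit g32's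
`ports/toruscap/build_toruscap.py`) to the dependency cone of the headline declarations `cap_first_period` (T ≤ 5m),
`cap_second_window` ([6m,7m]), `additiveLemma_holds` + `cap_first_gap` ([5m,6m]), `cap_le_seven`, `asymptoticCap4_le_seven`,
`fourPointFree_iff_triangleFree`, `fourPointFree_iff_delta4Free`, `primeGap_le_seven`, `primeGap_density_initial_segment`,
in a chain of 4 files of ≤ 400 lines (Theorems-side lint).  Statements byte-identical to the source EXCEPT (reuse, no
re-declaration): the vocabulary `BrauerFree`, `FourPointFree` and the lemma `brauerFree_of_fourPointFree` are the TREE's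
(`…Theorems.PrimeGapTorusCapPart1/Part6`, definitionally identical to the source's §0 `BrauerFree`/`FourPointFree`/
`FourPointFree.brauerFree`), the three dot-notation lemmas are renamed to flat names (`FourPointFree.delta4Free`/`.no_threeAP`/`.reflection` ↦ `fourPointFree_delta4Free`/`fourPointFree_no_threeAP`/`fourPointFree_reflection`) with their
five call sites rewritten, namespace `ParityIdeateP4R15` ↦ `Summit.Parity.GeneralizedHardyLittlewood.Theorems.PrimeGapInitialSegment`.
Non-Mathlib inputs: `Literature.NumberTheory.Sieve.PrimeGapLimitPoints` (`primeGapLimitSet`, `isClosed_primeGapLimitSet`, the NAMED fact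
`Merikoski2020_theorem1` = Merikoski 2020 Theorem 1, used HYPOTHESIS-STYLE, never asserted).  No `sorry`, no new axioms, no `instance`, no notation.
Cell-original mathematics (FRONTIER formalisation; record/instrument — nothing here bears on the parity problem): for a measurable
FOUR-POINT-FREE `U ⊆ (m,∞)` (no `x,y,z ∈ U` with `x+y, y+z, x+y+z ∈ U`) whose infimum `m ≥ 0` is approached from inside `U`,
`vol(U ∩ [0,T]) ≤ (T+m)/2` for every `T ≤ 7m` (one difference on `[0,5m]`; a reflection injection on `[6m,7m]`; one additive
lemma on the gap `[5m,6m]`); pay-off: given Merikoski's four-point theorem, with `c := sInf((0,∞) ∖ 𝓛)` the prime-gap limit-point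
set `𝓛` has `vol(𝓛 ∩ [0,T]) ≥ (T − c)/2` for all `0 ≤ T ≤ 7c` (print: `T/3`, [Merikoski2020GapLimitPoints, Cor. 2]).  The window
`(7m, 8m]` is OPEN (cell record: reduced to `HeavyBound`; pure cases proved; not in this port). HEADLINE DECLS IN THIS PART: `cap_second_window`.
-/

open Set MeasureTheory Filter
namespace Summit.Parity.GeneralizedHardyLittlewood.Theorems.PrimeGapInitialSegment
open Summit.Parity.GeneralizedHardyLittlewood.Theorems.PrimeGapTorusCap (BrauerFree FourPointFree brauerFree_of_fourPointFree)
open Literature.NumberTheory.Sieve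
section SecondWindow

/-- **REFLECTION LEMMA.** A measurable `P ⊆ [τ, u)` such that for all `t < t'` in `P` the reflected point
`t + u − t'` is not in `P` has measure `≤ (u − τ)/2`: reflect about a near-infimal point of `P`. -/
theorem volume_le_half_of_reflection {P : Set ℝ} (hP : MeasurableSet P) {τ u : ℝ} (hτu : τ ≤ u)
    (hsub : P ⊆ Ico τ u) (hrefl : ∀ t ∈ P, ∀ t' ∈ P, t < t' → t + u - t' ∉ P) :
    volume P ≤ ENNReal.ofReal ((u - τ) / 2) := by
  rcases P.eq_empty_or_nonempty with hPe | hne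
  · simp [hPe]
  have hbdd : BddBelow P := ⟨τ, fun t ht => (hsub ht).1⟩
  set a := sInf P with ha
  have hτa : τ ≤ a := le_csInf hne fun t ht => (hsub ht).1
  have hc : 0 ≤ (u - τ) / 2 := by linarith
  refine ENNReal.le_of_forall_pos_le_add fun η hη _ => ?_
  have hη' : (0:ℝ) < η := by exact_mod_cast hη
  obtain ⟨p₀, hp₀P, hp₀⟩ : ∃ p₀ ∈ P, p₀ < a + η := exists_lt_of_csInf_lt hne (by linarith)
  have hp₀u : p₀ < u := (hsub hp₀P).2
  have hτp₀ : τ ≤ p₀ := (hsub hp₀P).1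
  -- the part of `P` below `p₀` is short
  have hlow : volume (P ∩ Iic p₀) ≤ ENNReal.ofReal η := by
    calc volume (P ∩ Iic p₀) ≤ volume (Icc a p₀) :=
          measure_mono fun t ht => ⟨csInf_le hbdd ht.1, ht.2⟩
      _ = ENNReal.ofReal (p₀ - a) := Real.volume_Icc
      _ ≤ ENNReal.ofReal η := ENNReal.ofReal_le_ofReal (by linarith)
  -- the part above `p₀` and its reflection are disjoint subsets of `(p₀, u)`
  set Q : Set ℝ := P ∩ Ioi p₀ with hQ
  have hQm : MeasurableSet Q := hP.inter measurableSet_Ioi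
  set R : Set ℝ := (fun s : ℝ => p₀ + u - s) ⁻¹' Q with hR
  have hRm : MeasurableSet R := hQm.preimage (measurable_const.sub measurable_id)
  have hRvol : volume R = volume Q :=
    (Measure.measurePreserving_sub_left volume (p₀ + u)).measure_preimage hQm.nullMeasurableSet
  have hQsub : Q ⊆ Ioo p₀ u := fun t ht => ⟨ht.2, (hsub ht.1).2⟩
  have hRsub : R ⊆ Ioo p₀ u := by
    intro s hs
    have hs' : p₀ + u - s ∈ Q := hs
    have h1 : p₀ < p₀ + u - s := hs'.2
    have h2 : p₀ + u - s < u := (hsub hs'.1).2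
    exact ⟨by linarith, by linarith⟩
  have hdisj : Disjoint Q R := by
    refine Set.disjoint_left.2 fun s hsQ hsR => ?_
    have hs' : p₀ + u - s ∈ P := (show p₀ + u - s ∈ Q from hsR).1
    exact hrefl p₀ hp₀P s hsQ.1 hsQ.2 hs'
  have hQR : volume Q + volume Q ≤ ENNReal.ofReal (u - p₀) := by
    calc volume Q + volume Q = volume Q + volume R := by rw [hRvol]
      _ = volume (Q ∪ R) := (measure_union hdisj hRm).symm
      _ ≤ volume (Ioo p₀ u) := measure_mono (union_subset hQsub hRsub)
      _ = ENNReal.ofReal (u - p₀) := Real.volume_Ioo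
  have hQhalf : volume Q ≤ ENNReal.ofReal ((u - p₀) / 2) := by
    have h2 : 2 * volume Q ≤ ENNReal.ofReal (u - p₀) := by rwa [two_mul]
    rw [ENNReal.ofReal_div_of_pos (by norm_num : (0:ℝ) < 2), ENNReal.ofReal_ofNat,
      ENNReal.le_div_iff_mul_le (Or.inl (by norm_num)) (Or.inl (by simp)), mul_comm]
    exact h2
  calc volume P ≤ volume (P ∩ Iic p₀ ∪ Q) := measure_mono fun t ht => by
          rcases le_or_gt t p₀ with h | h
          · exact Or.inl ⟨ht, h⟩
          · exact Or.inr ⟨ht, h⟩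
    _ ≤ volume (P ∩ Iic p₀) + volume Q := measure_union_le _ _
    _ ≤ ENNReal.ofReal η + ENNReal.ofReal ((u - p₀) / 2) := add_le_add hlow hQhalf
    _ ≤ ENNReal.ofReal η + ENNReal.ofReal ((u - τ) / 2) :=
        add_le_add le_rfl (ENNReal.ofReal_le_ofReal (by linarith))
    _ = ENNReal.ofReal ((u - τ) / 2) + η := by rw [add_comm, ENNReal.ofReal_coe_nnreal]

variable {U : Set ℝ}
/-- **CORE OF THE SECOND WINDOW.** For a four-point-free measurable `U`, `u ∈ U`, `u > 0`, and
`0 ≤ τ ≤ u`: `vol(U ∩ [u, 6u + τ)) ≤ (7u + τ)/2`.  (Residue lines `t ∈ [0,u)`, positions `1..6`,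
position `6` only for `t < τ`; light lines `≤ 3`, heavy lines `= {1,2,4,5}` of measure `≤ (u−τ)/2`.) -/
theorem secondWindow_core (hUm : MeasurableSet U) (h4 : FourPointFree U) {u : ℝ} (hu : 0 < u)
    (huU : u ∈ U) {τ : ℝ} (hτ0 : 0 ≤ τ) (hτu : τ ≤ u) :
    volume (U ∩ Ico u (6 * u + τ)) ≤ ENNReal.ofReal ((7 * u + τ) / 2) := by
  -- residue-line sets: `L k = {t ∈ [0,u) : t + k u ∈ U}`
  set L : ℝ → Set ℝ := fun k => (fun t : ℝ => t + k * u) ⁻¹' U ∩ Ico 0 u with hL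
  have hLm : ∀ k, MeasurableSet (L k) := fun k =>
    (hUm.preimage (measurable_id.add_const _)).inter measurableSet_Ico
  have memL : ∀ {k t : ℝ}, t ∈ L k ↔ t + k * u ∈ U ∧ 0 ≤ t ∧ t < u := fun {k t} => by
    simp [hL, mem_Ico]
  -- the window pieces have the measures of the line sets
  have hpiece : ∀ k : ℝ, volume (U ∩ Ico (k * u) (k * u + u)) = volume (L k) := by
    intro k
    have e : L k = (fun t : ℝ => t + k * u) ⁻¹' (U ∩ Ico (k * u) (k * u + u)) := by
      ext t
      simp only [hL, mem_inter_iff, mem_preimage, mem_Ico]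
      constructor
      · rintro ⟨h1, h2, h3⟩; exact ⟨h1, by linarith, by linarith⟩
      · rintro ⟨h1, h2, h3⟩; exact ⟨h1, by linarith, by linarith⟩
    rw [e, measure_preimage_add_right]
  have hpiece6 : volume (U ∩ Ico (6 * u) (6 * u + τ)) = volume (L 6 ∩ Iio τ) := by
    have e : L 6 ∩ Iio τ = (fun t : ℝ => t + 6 * u) ⁻¹' (U ∩ Ico (6 * u) (6 * u + τ)) := by
      ext t
      simp only [hL, mem_inter_iff, mem_preimage, mem_Ico, mem_Iio]
      constructor
      · rintro ⟨⟨h1, h2, h3⟩, h4⟩; exact ⟨h1, by linarith, by linarith⟩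
      · rintro ⟨h1, h2, h3⟩; exact ⟨⟨h1, by linarith, by linarith⟩, by linarith⟩
    rw [e, measure_preimage_add_right]
  -- cover of the window by the six pieces
  have hcover : U ∩ Ico u (6 * u + τ) ⊆
      U ∩ Ico (1 * u) (1 * u + u) ∪ U ∩ Ico (2 * u) (2 * u + u) ∪ U ∩ Ico (3 * u) (3 * u + u) ∪
        U ∩ Ico (4 * u) (4 * u + u) ∪ U ∩ Ico (5 * u) (5 * u + u) ∪ U ∩ Ico (6 * u) (6 * u + τ) := by
    rintro x ⟨hxU, hx1, hx2⟩
    rcases lt_or_ge x (2 * u) with h2 | h2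
    · exact Or.inl (Or.inl (Or.inl (Or.inl (Or.inl ⟨hxU, by linarith, by linarith⟩))))
    rcases lt_or_ge x (3 * u) with h3 | h3
    · exact Or.inl (Or.inl (Or.inl (Or.inl (Or.inr ⟨hxU, by linarith, by linarith⟩))))
    rcases lt_or_ge x (4 * u) with h4' | h4'
    · exact Or.inl (Or.inl (Or.inl (Or.inr ⟨hxU, by linarith, by linarith⟩)))
    rcases lt_or_ge x (5 * u) with h5 | h5
    · exact Or.inl (Or.inl (Or.inr ⟨hxU, by linarith, by linarith⟩))
    rcases lt_or_ge x (6 * u) with h6 | h6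
    · exact Or.inl (Or.inr ⟨hxU, by linarith, by linarith⟩)
    · exact Or.inr ⟨hxU, h6, hx2⟩
  -- split each line set at `τ`
  set B : ℝ → Set ℝ := fun k => L k ∩ Ici τ with hB
  set C : ℝ → Set ℝ := fun k => L k ∩ Iio τ with hC
  have hBm : ∀ k, MeasurableSet (B k) := fun k => (hLm k).inter measurableSet_Ici
  have hCm : ∀ k, MeasurableSet (C k) := fun k => (hLm k).inter measurableSet_Iio
  have hsplit : ∀ k, volume (L k) = volume (B k) + volume (C k) := by
    intro k
    have e : L k = B k ∪ C k := by
      ext t; simp only [hB, hC, mem_union, mem_inter_iff, mem_Ici, mem_Iio]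
      constructor
      · intro ht; rcases le_or_gt τ t with h | h
        · exact Or.inl ⟨ht, h⟩
        · exact Or.inr ⟨ht, h⟩
      · rintro (⟨ht, _⟩ | ⟨ht, _⟩) <;> exact ht
    have hd : Disjoint (B k) (C k) := Set.disjoint_left.2 fun t htB htC => by
      have h1 : τ ≤ t := htB.2
      have h2 : t < τ := htC.2
      linarith
    rw [e, measure_union hd (hCm k)]
  have hBS : ∀ k, B k ⊆ Ico τ u := fun k t ht => ⟨ht.2, (memL.1 ht.1).2.2⟩
  have hCS : ∀ k, C k ⊆ Ico 0 τ := fun k t ht => ⟨(memL.1 ht.1).2.1, ht.2⟩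
  -- no three-term progressions of step `u` along a line
  have hAP : ∀ (k : ℝ) (t : ℝ), t ∈ L k → t ∈ L (k + 1) → t ∈ L (k + 2) → False := by
    intro k t h0 h1 h2
    have h0' := (memL.1 h0).1
    have h1' := (memL.1 h1).1
    have h2' := (memL.1 h2).1
    refine fourPointFree_no_threeAP h4 huU h0' ?_ ?_
    · have e : t + k * u + u = t + (k + 1) * u := by ring
      rwa [e]
    · have e : t + k * u + 2 * u = t + (k + 2) * u := by ring
      rwa [e]
  -- light lines: `C`-part `≤ 4τ`, `B`-part `≤ 3(u − τ) + heavy`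
  have hC123 : volume (C 1) + volume (C 2) + volume (C 3) ≤ volume (Ico 0 τ) + volume (Ico 0 τ) :=
    measure_three_le (hCm 2) (hCm 3) (hCS 1) (hCS 2) (hCS 3) fun t ht1 ht2 ht3 =>
      hAP 1 t ht1.1 (by norm_num; exact ht2.1) (by norm_num; exact ht3.1)
  have hC456 : volume (C 4) + volume (C 5) + volume (C 6) ≤ volume (Ico 0 τ) + volume (Ico 0 τ) :=
    measure_three_le (hCm 5) (hCm 6) (hCS 4) (hCS 5) (hCS 6) fun t ht1 ht2 ht3 =>
      hAP 4 t ht1.1 (by norm_num; exact ht2.1) (by norm_num; exact ht3.1)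
  set P : Set ℝ := B 1 ∩ B 2 ∩ B 4 ∩ B 5 with hPdef
  have hPm : MeasurableSet P := (((hBm 1).inter (hBm 2)).inter (hBm 4)).inter (hBm 5)
  have hB5 : volume (B 1) + volume (B 2) + volume (B 3) + volume (B 4) + volume (B 5) ≤
      volume (Ico τ u) + volume (Ico τ u) + volume (Ico τ u) + volume P :=
    measure_five_le (hBm 1) (hBm 2) (hBm 3) (hBm 4) (hBm 5) (hBS 1) (hBS 2) (hBS 3) (hBS 4) (hBS 5)
      (fun t ht1 ht2 ht3 => hAP 1 t ht1.1 (by norm_num; exact ht2.1) (by norm_num; exact ht3.1))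
      (fun t ht3 ht4 ht5 => hAP 3 t ht3.1 (by norm_num; exact ht4.1) (by norm_num; exact ht5.1))
  -- heavy lines: the reflection injection
  have hPsub : P ⊆ Ico τ u := fun t ht => hBS 1 ht.1.1.1
  have hPhalf : volume P ≤ ENNReal.ofReal ((u - τ) / 2) := by
    refine volume_le_half_of_reflection hPm hτu hPsub fun t ht t' ht' htt' hs => ?_
    -- `t ∈ L 4 ∩ L 5`, `t' ∈ L 2`, `s = t + u - t' ∈ L 1 ∩ L 2`
    have ht4 : t + 4 * u ∈ U := (memL.1 ht.1.2.1).1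
    have ht5 : t + 5 * u ∈ U := (memL.1 ht.2.1).1
    have ht'2 : t' + 2 * u ∈ U := (memL.1 ht'.1.1.2.1).1
    have hs1 : t + u - t' + 1 * u ∈ U := (memL.1 hs.1.1.1.1).1
    have hs2 : t + u - t' + 2 * u ∈ U := (memL.1 hs.1.1.2.1).1
    refine fourPointFree_reflection h4 huU ht'2 ht4 ht5 ?_ ?_
    · have e : t + u - t' + 1 * u = t + 2 * u - t' := by ring
      rwa [e] at hs1
    · have e : t + u - t' + 2 * u = t + 3 * u - t' := by ring
      rwa [e] at hs2
  -- assemble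
  have hIco0 : volume (Ico 0 τ) = ENNReal.ofReal τ := by simp [Real.volume_Ico]
  have hIcoτ : volume (Ico τ u) = ENNReal.ofReal (u - τ) := Real.volume_Ico
  calc volume (U ∩ Ico u (6 * u + τ))
      ≤ volume (U ∩ Ico (1 * u) (1 * u + u) ∪ U ∩ Ico (2 * u) (2 * u + u) ∪
          U ∩ Ico (3 * u) (3 * u + u) ∪ U ∩ Ico (4 * u) (4 * u + u) ∪ U ∩ Ico (5 * u) (5 * u + u) ∪
          U ∩ Ico (6 * u) (6 * u + τ)) := measure_mono hcover
    _ ≤ volume (U ∩ Ico (1 * u) (1 * u + u)) + volume (U ∩ Ico (2 * u) (2 * u + u)) +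
          volume (U ∩ Ico (3 * u) (3 * u + u)) + volume (U ∩ Ico (4 * u) (4 * u + u)) +
          volume (U ∩ Ico (5 * u) (5 * u + u)) + volume (U ∩ Ico (6 * u) (6 * u + τ)) := by
        refine (measure_union_le _ _).trans ?_; gcongr
        refine (measure_union_le _ _).trans ?_; gcongr
        refine (measure_union_le _ _).trans ?_; gcongr
        refine (measure_union_le _ _).trans ?_; gcongr
        exact measure_union_le _ _
    _ = volume (L 1) + volume (L 2) + volume (L 3) + volume (L 4) + volume (L 5) +
          volume (L 6 ∩ Iio τ) := by rw [hpiece, hpiece, hpiece, hpiece, hpiece, hpiece6]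
    _ = (volume (B 1) + volume (B 2) + volume (B 3) + volume (B 4) + volume (B 5)) +
          (volume (C 1) + volume (C 2) + volume (C 3)) + (volume (C 4) + volume (C 5) + volume (C 6)) := by
        rw [hsplit, hsplit, hsplit, hsplit, hsplit]
        show _ = _ + _ + (volume (C 4) + volume (C 5) + volume (L 6 ∩ Iio τ))
        ring
    _ ≤ (volume (Ico τ u) + volume (Ico τ u) + volume (Ico τ u) + volume P) +
          (volume (Ico 0 τ) + volume (Ico 0 τ)) + (volume (Ico 0 τ) + volume (Ico 0 τ)) :=
        add_le_add (add_le_add hB5 hC123) hC456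
    _ ≤ (ENNReal.ofReal (u - τ) + ENNReal.ofReal (u - τ) + ENNReal.ofReal (u - τ) +
          ENNReal.ofReal ((u - τ) / 2)) + (ENNReal.ofReal τ + ENNReal.ofReal τ) +
          (ENNReal.ofReal τ + ENNReal.ofReal τ) := by
        rw [hIco0, hIcoτ]; gcongr
    _ = ENNReal.ofReal ((7 * u + τ) / 2) := by
        have h1 : 0 ≤ u - τ := by linarith
        have h2 : 0 ≤ (u - τ) / 2 := by linarith
        rw [← ENNReal.ofReal_add h1 h1, ← ENNReal.ofReal_add (by linarith) h1,
          ← ENNReal.ofReal_add (by linarith) h2, ← ENNReal.ofReal_add hτ0 hτ0,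
          ← ENNReal.ofReal_add (by linarith) (by linarith),
          ← ENNReal.ofReal_add (by linarith) (by linarith)]
        congr 1; ring

/-- **THE SECOND WINDOW** (new rung of `(A∞')`, beyond the one-difference method of ROUND-13 which stops at
`T = 5m`): for a four-point-free measurable `U ⊆ (m,∞)` whose infimum `m ≥ 0` is approached from inside `U`,
`vol(U ∩ [0,T]) ≤ (T + m)/2` for every `T ∈ [6m, 7m]`. -/
theorem cap_second_window (hUm : MeasurableSet U) (h4 : FourPointFree U) {m : ℝ} (hm : 0 ≤ m)
    (hUgt : U ⊆ Ioi m) (hinf : ∀ ε > 0, ∃ u ∈ U, u < m + ε) {T : ℝ} (h6 : 6 * m ≤ T)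
    (h7 : T ≤ 7 * m) :
    volume (U ∩ Icc 0 T) ≤ ENNReal.ofReal ((T + m) / 2) := by
  have hc : 0 ≤ (T + m) / 2 := by linarith
  have key : ∀ δ : ℝ, 0 < δ → volume (U ∩ Icc 0 T) ≤ ENNReal.ofReal ((T + m) / 2 + δ) := by
    intro δ hδ
    obtain ⟨u, huU, hu⟩ := hinf (δ / 5) (by linarith)
    have hmu : m < u := hUgt huU
    have hu0 : 0 < u := lt_of_le_of_lt hm hmu
    set τ : ℝ := T - 6 * m with hτ
    have hτ0 : 0 ≤ τ := by linarith
    have hτu : τ ≤ u := by linarith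
    have hcov : U ∩ Icc 0 T ⊆ Ioo m u ∪ U ∩ Ico u (6 * u + τ) ∪ {6 * u + τ} := by
      rintro x ⟨hxU, hx0, hxT⟩
      have hxm : m < x := hUgt hxU
      rcases lt_or_ge x u with h | h
      · exact Or.inl (Or.inl ⟨hxm, h⟩)
      rcases lt_or_ge x (6 * u + τ) with h' | h'
      · exact Or.inl (Or.inr ⟨hxU, h, h'⟩)
      · have : x = 6 * u + τ := le_antisymm (by linarith) h'
        exact Or.inr this
    calc volume (U ∩ Icc 0 T)
        ≤ volume (Ioo m u ∪ U ∩ Ico u (6 * u + τ) ∪ {6 * u + τ}) := measure_mono hcov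
      _ ≤ volume (Ioo m u) + volume (U ∩ Ico u (6 * u + τ)) + volume ({6 * u + τ} : Set ℝ) :=
          (measure_union_le _ _).trans (add_le_add (measure_union_le _ _) le_rfl)
      _ ≤ ENNReal.ofReal (u - m) + ENNReal.ofReal ((7 * u + τ) / 2) + 0 := by
          rw [Real.volume_Ioo, Real.volume_singleton]
          gcongr
          exact secondWindow_core hUm h4 hu0 huU hτ0 hτu
      _ ≤ ENNReal.ofReal ((T + m) / 2 + δ) := by
          rw [add_zero, ← ENNReal.ofReal_add (by linarith) (by linarith)]
          exact ENNReal.ofReal_le_ofReal (by rw [hτ]; linarith)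
  refine ENNReal.le_of_forall_pos_le_add fun ε hε _ => ?_
  calc volume (U ∩ Icc 0 T) ≤ ENNReal.ofReal ((T + m) / 2 + ε) := key ε (by exact_mod_cast hε)
    _ = ENNReal.ofReal ((T + m) / 2) + ε := by
        rw [ENNReal.ofReal_add hc ε.coe_nonneg, ENNReal.ofReal_coe_nnreal]

end SecondWindow
/-! ## §2b The first gap `[5m, 6m]` — hence the cap on ALL of `[0, 7m]` — via ONE additive lemma

On the window `T = 5m + τ` the residue lines `t < τ` carry five positions (heavy word `{1,2,4,5}`), the
lines `t ≥ τ` four (weight-3 words `{1,2,4}`, `{1,3,4}`).  With `S := L₁ ∩ L₂ ∩ L₄` and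
`R := L₃ ∩ L₄ ∩ [τ,u)` the four-point patterns `(s+2u, s'+u, u)` and `(s+u, u, s'+u)` say exactly:
`(α)` `S + S` (sums `< u`) avoids `R`, and `(β)` `S + S − u` (sums `≥ u`) avoids `S ∪ R`; and the trivial
bookkeeping (`measure_five_le`, `measure_four_le`) gives `vol(U ∩ [u, 5u+τ)) ≤ 2u + τ + vol S + vol R`.
So the cap on the first gap follows from the ADDITIVE LEMMA `vol S + vol R ≤ u − τ/2` (sharp:
`S = [0,τ/2)`, `R = [τ,u)`), a statement about two measurable subsets of `[0,u)` — which is PROVED here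
(`additiveLemma_holds`) by an elementary one-anchor argument: for `b ∈ S` near `sup S` the sets
`S ∩ [0,b)`, `(S ∩ [0,u−b)) + b`, `(S ∩ [u−b,b)) + b − u` are pairwise disjoint, inside `[0,u)`, of total
measure `2·vol(S ∩ [0,b))` and disjoint from `R`, so `2·vol S + vol R ≤ u` (a Raikov-type inequality
obtained without Raikov's theorem); average with `vol R ≤ u − τ`.  Consequently the cap
`vol(U ∩ [0,T]) ≤ (T + m)/2` is a theorem for EVERY `T ≤ 7m` (`cap_le_seven`), and so is the `𝓛` pay-off
`vol(𝓛 ∩ [0,T]) ≥ (T − c)/2` for all `0 ≤ T ≤ 7c` (`primeGap_le_seven`, §3). -/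

section FirstGap
/-- Four measurable subsets `B₁,…,B₄ ⊆ S` with `B₁ ∩ B₂ ∩ B₃ = ∅ = B₂ ∩ B₃ ∩ B₄` have total measure
`≤ 2·vol S + vol(B₁ ∩ B₄ ∩ (B₂ ∪ B₃))` (pointwise: a no-`111` word on four positions has weight `≤ 2`
unless it is `{1,2,4}` or `{1,3,4}`). -/
theorem measure_four_le {B₁ B₂ B₃ B₄ S : Set ℝ} (_h₁ : MeasurableSet B₁) (h₂ : MeasurableSet B₂)
    (h₃ : MeasurableSet B₃) (h₄ : MeasurableSet B₄)
    (h₁S : B₁ ⊆ S) (h₂S : B₂ ⊆ S) (h₃S : B₃ ⊆ S) (h₄S : B₄ ⊆ S)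
    (h123 : ∀ t, t ∈ B₁ → t ∈ B₂ → t ∈ B₃ → False) (h234 : ∀ t, t ∈ B₂ → t ∈ B₃ → t ∈ B₄ → False) :
    volume B₁ + volume B₂ + volume B₃ + volume B₄ ≤
      volume S + volume S + volume (B₁ ∩ B₄ ∩ (B₂ ∪ B₃)) := by
  set X : Set ℝ := B₁ ∩ B₄ with hX
  set Y : Set ℝ := B₂ ∪ B₃ with hY
  set Z : Set ℝ := B₂ ∩ B₃ with hZ
  have hYm : MeasurableSet Y := h₂.union h₃
  have hZm : MeasurableSet Z := h₂.inter h₃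
  have e14 : volume B₁ + volume B₄ = volume (B₁ ∪ B₄) + volume X :=
    (measure_union_add_inter B₁ h₄).symm
  have e23 : volume B₂ + volume B₃ = volume Y + volume Z :=
    (measure_union_add_inter B₂ h₃).symm
  have eXY : volume X + volume Y = volume (X ∪ Y) + volume (X ∩ Y) :=
    (measure_union_add_inter X hYm).symm
  have hdisj : Disjoint (B₁ ∪ B₄) Z := Set.disjoint_left.2 fun t ht htZ => by
    rcases ht with ht1 | ht4
    · exact h123 t ht1 htZ.1 htZ.2
    · exact h234 t htZ.1 htZ.2 ht4
  have eUZ : volume (B₁ ∪ B₄) + volume Z = volume (B₁ ∪ B₄ ∪ Z) := (measure_union hdisj hZm).symm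
  have hS1 : B₁ ∪ B₄ ∪ Z ⊆ S := union_subset (union_subset h₁S h₄S) (inter_subset_left.trans h₂S)
  have hS2 : X ∪ Y ⊆ S := union_subset (inter_subset_left.trans h₁S) (union_subset h₂S h₃S)
  calc volume B₁ + volume B₂ + volume B₃ + volume B₄
      = (volume B₁ + volume B₄) + (volume B₂ + volume B₃) := by ring
    _ = (volume (B₁ ∪ B₄) + volume Z) + (volume X + volume Y) := by rw [e14, e23]; ring
    _ = volume (B₁ ∪ B₄ ∪ Z) + (volume (X ∪ Y) + volume (X ∩ Y)) := by rw [eUZ, eXY]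
    _ ≤ volume S + (volume S + volume (X ∩ Y)) :=
        add_le_add (measure_mono hS1) (add_le_add (measure_mono hS2) le_rfl)
    _ = volume S + volume S + volume (B₁ ∩ B₄ ∩ (B₂ ∪ B₃)) := by rw [add_assoc]

/-- THE ADDITIVE LEMMA the first gap reduces to (a statement about two measurable subsets of `[0,u)`;
proved below, `additiveLemma_holds`; equality at `S = [0,τ/2)`, `R = [τ,u)`). -/
def AdditiveLemma : Prop :=
  ∀ (u τ : ℝ) (S R : Set ℝ), 0 < u → 0 ≤ τ → τ ≤ u → MeasurableSet S → MeasurableSet R →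
    S ⊆ Ico 0 u → R ⊆ Ico τ u → Disjoint S R →
    (∀ s ∈ S, ∀ s' ∈ S, s + s' < u → s + s' ∉ R) →
    (∀ s ∈ S, ∀ s' ∈ S, u ≤ s + s' → s + s' - u ∉ S ∧ s + s' - u ∉ R) →
    volume S + volume R ≤ ENNReal.ofReal (u - τ / 2)

end FirstGap
end Summit.Parity.GeneralizedHardyLittlewood.Theorems.PrimeGapInitialSegment
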